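import Mathlib
import Summits.CriticalPhenomena.CardyFormulaZ2.Theorems.CardyMagicRigidityHexSegmentDefs
import Summits.CriticalPhenomena.CardyFormulaZ2.Theorems.CardyMagicRigidityLoopLimitZ2EqTSiteEndCoords
import Literature.Probability.Percolation.TriBoxCrossingProofs
import Literature.Probability.RandomPlanarGeometry.PlanarDomainsTopology
import HarnessLib

/-!
# Stub `stub_siteEndCrossings` (S7a), line `Sketch`, crux `LoopLimitZ2EqT` (stmt-CriticalPhenomena-4833):
# corners of up-cells, metric bookkeeping

Helper file (`--supports stmt-CriticalPhenomena-4833`). At `t = 0` the bond configuration of the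
segment model is a.s. the **all-or-nothing** configuration `A σ = {upEdge x k | x ∈ σ}` of the
fair-coin layer `σ` (`siteEnd_ae_cfg`): all three edges of the up-cell `{x, x + e₀, x + e₁}` of
`triGraph` are open iff `x ∈ σ`. This file is the combinatorial dictionary between the corners of
up-cells and their anchors (two up-cells share a corner iff their anchors are equal or `𝕋`-adjacent;
the endpoints of `upEdge x k` are corners of the cell at `x`; two distinct corners of a cell span one
of its edges), written in coordinates — "`c` is a corner of the cell at `x`" is
`(c 0 = x 0 ∧ c 1 = x 1) ∨ (c 0 = x 0 + 1 ∧ c 1 = x 1) ∨ (c 0 = x 0 ∧ c 1 = x 1 + 1)` —, plus two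
metric facts used by the sandwich inclusions (`siteEndCrossings_le_infDist_add`,
`siteEndCrossings_frontier_subset`).
-/

noncomputable section

open Set Metric

namespace Summit.CriticalPhenomena.CardyFormulaZ2.Cruxes.LoopLimitZ2EqT.HexSegment

open Literature.Probability.Percolation Literature.Probability.LatticeModels
  Literature.Probability.RandomPlanarGeometry

/-! ### Corners of up-cells -/

/-- A corner of the up-cell at `x` is `x`, `x + e₀` or `x + e₁`. -/
theorem siteEndCrossings_corner_eq {x c : Site 2}
    (h : (c 0 = x 0 ∧ c 1 = x 1) ∨ (c 0 = x 0 + 1 ∧ c 1 = x 1) ∨ (c 0 = x 0 ∧ c 1 = x 1 + 1)) :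
    c = x ∨ c = x + ![1, 0] ∨ c = x + ![0, 1] := by
  rcases h with h | h | h
  · left; ext i; fin_cases i
    · simpa using h.1
    · simpa using h.2
  · right; left; ext i; fin_cases i
    · simpa using h.1
    · simpa using h.2
  · right; right; ext i; fin_cases i
    · simpa using h.1
    · simpa using h.2

/-- The two endpoints of the edge `upEdge x k` are corners of the up-cell at `x`. -/
theorem siteEndCrossings_corner_of_upEdge {a b x : Site 2} {k : Fin 3} (h : s(a, b) = upEdge x k) :
    ((a 0 = x 0 ∧ a 1 = x 1) ∨ (a 0 = x 0 + 1 ∧ a 1 = x 1) ∨ (a 0 = x 0 ∧ a 1 = x 1 + 1)) ∧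
    ((b 0 = x 0 ∧ b 1 = x 1) ∨ (b 0 = x 0 + 1 ∧ b 1 = x 1) ∨ (b 0 = x 0 ∧ b 1 = x 1 + 1)) := by
  fin_cases k
  · simp only [upEdge, Fin.zero_eta, Fin.isValue, ↓reduceIte] at h
    rcases Sym2.eq_iff.1 h with ⟨rfl, rfl⟩ | ⟨rfl, rfl⟩
    · exact ⟨Or.inl ⟨rfl, rfl⟩, Or.inr (Or.inl ⟨by simp, by simp⟩)⟩
    · exact ⟨Or.inr (Or.inl ⟨by simp, by simp⟩), Or.inl ⟨rfl, rfl⟩⟩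
  · simp only [upEdge, Fin.mk_one, Fin.isValue, one_ne_zero, ↓reduceIte] at h
    rcases Sym2.eq_iff.1 h with ⟨rfl, rfl⟩ | ⟨rfl, rfl⟩
    · exact ⟨Or.inl ⟨rfl, rfl⟩, Or.inr (Or.inr ⟨by simp, by simp⟩)⟩
    · exact ⟨Or.inr (Or.inr ⟨by simp, by simp⟩), Or.inl ⟨rfl, rfl⟩⟩
  · simp only [upEdge, Fin.reduceFinMk, Fin.isValue, Fin.reduceEq, ↓reduceIte] at h
    rcases Sym2.eq_iff.1 h with ⟨rfl, rfl⟩ | ⟨rfl, rfl⟩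
    · exact ⟨Or.inr (Or.inl ⟨by simp, by simp⟩), Or.inr (Or.inr ⟨by simp, by simp⟩)⟩
    · exact ⟨Or.inr (Or.inr ⟨by simp, by simp⟩), Or.inr (Or.inl ⟨by simp, by simp⟩)⟩

/-- Two distinct corners of the up-cell at `x` span one of its three edges. -/
theorem siteEndCrossings_upEdge_of_corners {x a b : Site 2}
    (ha : (a 0 = x 0 ∧ a 1 = x 1) ∨ (a 0 = x 0 + 1 ∧ a 1 = x 1) ∨ (a 0 = x 0 ∧ a 1 = x 1 + 1))
    (hb : (b 0 = x 0 ∧ b 1 = x 1) ∨ (b 0 = x 0 + 1 ∧ b 1 = x 1) ∨ (b 0 = x 0 ∧ b 1 = x 1 + 1))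
    (hab : a ≠ b) : ∃ k, s(a, b) = upEdge x k := by
  rcases siteEndCrossings_corner_eq ha with rfl | rfl | rfl <;>
    rcases siteEndCrossings_corner_eq hb with rfl | rfl | rfl
  · exact (hab rfl).elim
  · exact ⟨0, by simp [upEdge]⟩
  · exact ⟨1, by simp [upEdge]⟩
  · exact ⟨0, by simp [upEdge, Sym2.eq_swap]⟩
  · exact (hab rfl).elim
  · exact ⟨2, by simp [upEdge]⟩
  · exact ⟨1, by simp [upEdge, Sym2.eq_swap]⟩
  · exact ⟨2, by simp [upEdge, Sym2.eq_swap]⟩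
  · exact (hab rfl).elim

/-- Two corners of one up-cell are equal or `𝕋`-adjacent. -/
theorem siteEndCrossings_corner_eq_or_adj {x a b : Site 2}
    (ha : (a 0 = x 0 ∧ a 1 = x 1) ∨ (a 0 = x 0 + 1 ∧ a 1 = x 1) ∨ (a 0 = x 0 ∧ a 1 = x 1 + 1))
    (hb : (b 0 = x 0 ∧ b 1 = x 1) ∨ (b 0 = x 0 + 1 ∧ b 1 = x 1) ∨ (b 0 = x 0 ∧ b 1 = x 1 + 1)) :
    a = b ∨ triGraph.Adj a b := by
  refine siteEnd_eq_or_adj_of_coords ?_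
  rcases ha with ha | ha | ha <;> rcases hb with hb | hb | hb <;> omega

/-- Two corners of one up-cell are within one mesh of each other. -/
theorem siteEndCrossings_dist_corner_le {x a b : Site 2} {δ : ℝ} (hδ : 0 < δ)
    (ha : (a 0 = x 0 ∧ a 1 = x 1) ∨ (a 0 = x 0 + 1 ∧ a 1 = x 1) ∨ (a 0 = x 0 ∧ a 1 = x 1 + 1))
    (hb : (b 0 = x 0 ∧ b 1 = x 1) ∨ (b 0 = x 0 + 1 ∧ b 1 = x 1) ∨ (b 0 = x 0 ∧ b 1 = x 1 + 1)) :
    dist (triMeshPoint δ a) (triMeshPoint δ b) ≤ δ := by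
  rcases siteEndCrossings_corner_eq_or_adj ha hb with rfl | h
  · rw [dist_self]; exact hδ.le
  · rw [dist_triMeshPoint_of_triGraph_adj h, abs_of_pos hδ]

/-- A corner of the up-cell at `x` is within one mesh of its anchor `x`. -/
theorem siteEndCrossings_dist_anchor_le {x c : Site 2} {δ : ℝ} (hδ : 0 < δ)
    (hc : (c 0 = x 0 ∧ c 1 = x 1) ∨ (c 0 = x 0 + 1 ∧ c 1 = x 1) ∨ (c 0 = x 0 ∧ c 1 = x 1 + 1)) :
    dist (triMeshPoint δ c) (triMeshPoint δ x) ≤ δ :=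
  siteEndCrossings_dist_corner_le hδ hc (Or.inl ⟨rfl, rfl⟩)

/-- **Two up-cells sharing a corner have equal or `𝕋`-adjacent anchors.** -/
theorem siteEndCrossings_anchor_eq_or_adj : ∀ {x y c : Site 2},
    ((c 0 = x 0 ∧ c 1 = x 1) ∨ (c 0 = x 0 + 1 ∧ c 1 = x 1) ∨ (c 0 = x 0 ∧ c 1 = x 1 + 1)) →
    ((c 0 = y 0 ∧ c 1 = y 1) ∨ (c 0 = y 0 + 1 ∧ c 1 = y 1) ∨ (c 0 = y 0 ∧ c 1 = y 1 + 1)) →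
    x = y ∨ triGraph.Adj x y := by
  intro x y c hx hy
  refine siteEnd_eq_or_adj_of_coords ?_
  rcases hx with hx | hx | hx <;> rcases hy with hy | hy | hy <;> omega

/-- **`𝕋`-adjacent anchors have up-cells sharing a corner.** -/
theorem siteEndCrossings_exists_shared_corner {x y : Site 2} (h : triGraph.Adj x y) :
    ∃ c : Site 2, ((c 0 = x 0 ∧ c 1 = x 1) ∨ (c 0 = x 0 + 1 ∧ c 1 = x 1) ∨ (c 0 = x 0 ∧ c 1 = x 1 + 1)) ∧
      ((c 0 = y 0 ∧ c 1 = y 1) ∨ (c 0 = y 0 + 1 ∧ c 1 = y 1) ∨ (c 0 = y 0 ∧ c 1 = y 1 + 1)) := by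
  rcases triGraph_adj_apply h with h | h | h | h | h | h
  · exact ⟨y, Or.inr (Or.inl h), Or.inl ⟨rfl, rfl⟩⟩
  · exact ⟨y, Or.inr (Or.inr h), Or.inl ⟨rfl, rfl⟩⟩
  · exact ⟨x, Or.inl ⟨rfl, rfl⟩, Or.inr (Or.inl h)⟩
  · exact ⟨x, Or.inl ⟨rfl, rfl⟩, Or.inr (Or.inr h)⟩
  · refine ⟨![x 0 + 1, x 1], Or.inr (Or.inl ⟨by simp, by simp⟩), Or.inr (Or.inr ⟨?_, ?_⟩)⟩
    · simp; omega
    · simp; omega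
  · refine ⟨![y 0 + 1, y 1], Or.inr (Or.inr ⟨?_, ?_⟩), Or.inr (Or.inl ⟨by simp, by simp⟩)⟩
    · simp; omega
    · simp; omega

/-! ### Metric bookkeeping -/

/-- **Separated sets**: if `dist(A, B) > d` then `d ≤ infDist z A + infDist w B + dist z w`. -/
theorem siteEndCrossings_le_infDist_add {A B : Set ℂ} {d : ℝ} (hA : A.Nonempty) (hB : B.Nonempty)
    (hd : ∀ a ∈ A, ∀ b ∈ B, d < dist a b) (z w : ℂ) : d ≤ infDist z A + infDist w B + dist z w := by
  by_contra hlt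
  push Not at hlt
  set η := (d - (infDist z A + infDist w B + dist z w)) / 2 with hη
  have hη0 : 0 < η := by rw [hη]; linarith
  obtain ⟨a, ha, hza⟩ := (infDist_lt_iff hA).1 (show infDist z A < infDist z A + η by linarith)
  obtain ⟨b, hb, hwb⟩ := (infDist_lt_iff hB).1 (show infDist w B < infDist w B + η by linarith)
  have h1 := hd a ha b hb
  have h2 := dist_triangle4 a z w b
  rw [dist_comm] at hza
  linarith

/-- The arcs of a conformal rectangle cover its frontier, grouped as `(arc i ∪ arc j) ∪ (arc 1 ∪ arc 3)`
for `{i, j} = {0, 2}`. -/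
theorem siteEndCrossings_frontier_subset (D : ConformalRectangle) :
    frontier D.carrier ⊆ (D.arc 0 ∪ D.arc 2) ∪ (D.arc 1 ∪ D.arc 3) ∧
    frontier D.carrier ⊆ (D.arc 2 ∪ D.arc 0) ∪ (D.arc 1 ∪ D.arc 3) := by
  have key : ∀ x ∈ frontier D.carrier, (x ∈ D.arc 0 ∨ x ∈ D.arc 2) ∨ (x ∈ D.arc 1 ∨ x ∈ D.arc 3) := by
    intro x hx
    rw [← (D.iUnion_arc_holds : ⋃ i, D.arc i = frontier D.carrier), mem_iUnion] at hx
    obtain ⟨i, hi⟩ := hx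
    fin_cases i
    · exact Or.inl (Or.inl hi)
    · exact Or.inr (Or.inl hi)
    · exact Or.inl (Or.inr hi)
    · exact Or.inr (Or.inr hi)
  refine ⟨fun x hx => key x hx, fun x hx => ?_⟩
  rcases key x hx with (h | h) | h
  · exact Or.inl (Or.inr h)
  · exact Or.inl (Or.inl h)
  · exact Or.inr h

end Summit.CriticalPhenomena.CardyFormulaZ2.Cruxes.LoopLimitZ2EqT.HexSegment

end
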